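import Literature.AnabelianGeometry.SemiGraphs.HomRestrict

/-!
# Nested restriction `𝒢|_{K̄} ⇝ 𝒢|_K` (`K ⊆ K̄`) and the restricted morphisms `φ|_K`, `φ|_{K̄}` — DEFINITIONS

Mochizuki, *Semi-graphs of anabelioids*, Publ. RIMS **42** (2006), §1 p. 12 (sub-semi-graphs),
Def. 2.1 p. 24 (`𝒢_ℍ`, `Π_ℍ → Π_𝒢`), and §2 p. 30, proof of Corollary 2.7 (i): the restriction
`ℋ′ → ℍ` of a finite étale covering `𝒢′ → 𝒢` to `ℍ` and "a connected component `ℋ″` of `ℋ′`" —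
i.e. TWO nested sub-semi-graphs `K ⊆ K̄ ⊆ 𝔾′` (`K̄ = φ⁻¹(ℍ)`, `K` a component) and the two restricted
morphisms `φ|_K`, `φ|_{K̄}` (`HomRestrict.lean`). [cite: MochizukiSemiAnbd2006, Cor. 2.7(i) p.30]

This file supplies the bookkeeping between them (abc-iut cell, layer L3, D3b cut α7-1, pieces
(CORE)/(COMP): the image of `Π_K → Π_ℍ` versus that of `Π_{K̄} → Π_ℍ`):

* `SemiGraph.Subgraph.inclusion K K̄ hV hE : K.toSemiGraph ⟶ K̄.toSemiGraph` — the inclusion of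
  nested sub-semi-graphs (the restriction of `𝟙 G`);
* `SemiGraphOfAnabelioids.restrictFunctor₂ 𝒢 K̄ K hV hE : B(𝒢|_{K̄}) ⥤ B(𝒢|_K)` — restricting the
  data of an object further, with `(−)|_{K̄} ⋙ restrictFunctor₂ = (−)|_K` and
  `restrictFunctor₂ ⋙ ρ^K_w = ρ^{K̄}_w` definitionally;
* `Hom.restrict_pullbackFunctor_comp_restrictFunctor₂ : (φ|_{K̄})^* ⋙ restrictFunctor₂ = (φ|_K)^*`
  and the resulting factorisation of the induced homomorphisms
  `ι_{φ|_K} = ι_{φ|_{K̄}} ∘ π₁(restrictFunctor₂)` (`Hom.ι_restrict_eq_comp`), whence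
  `image(Π_K → Π_ℍ) = ι_{φ|_{K̄}}(image(Π_K → Π_{K̄}))` (`Hom.range_ι_restrict_eq_map`) and
  `= image(Π_{K̄} → Π_ℍ)` as soon as `Π_K → Π_{K̄}` (automorphisms of the basepoints through a vertex
  of `K`) is onto (`Hom.range_ι_restrict_eq_of_surjective`) — the surjectivity, for `K` a union of
  connected components of `K̄`, is the (COMP) piece and is NOT proved here.

Definitions and definitional bookkeeping only; no facts are asserted; nothing here takes a side on
[IUTchIII] Cor. 3.12.
-/

namespace Literature.AnabelianGeometry.SemiGraphs

open CategoryTheory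
open Literature.AnabelianGeometry.Anabelioids

universe w v₁ u₁ u

/-! ### Semi-graphs: the inclusion of nested sub-semi-graphs -/

namespace SemiGraph.Subgraph

variable {G : SemiGraph.{u}}

/-- The inclusion `K ↪ K̄` of nested sub-semi-graphs `K ⊆ K̄ ⊆ G` as a morphism of semi-graphs
(the restriction of the identity of `G`; §1 p. 12). [cite: MochizukiSemiAnbd2006, §1 p.12] -/
noncomputable def inclusion (K K' : G.Subgraph) (hV : K.verts ⊆ K'.verts) (hE : K.edges ⊆ K'.edges) :
    K.toSemiGraph ⟶ K'.toSemiGraph :=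
  SemiGraph.Hom.restrict (𝟙 G) K K' hV hE

/-- Vertices: the inclusion is the identity on underlying vertices. [cite: MochizukiSemiAnbd2006, §1 p.12] -/
@[simp] theorem inclusion_vertexMap_coe (K K' : G.Subgraph) (hV : K.verts ⊆ K'.verts)
    (hE : K.edges ⊆ K'.edges) (v : K.toSemiGraph.Vertex) :
    ((inclusion K K' hV hE).vertexMap v).1 = v.1 := rfl

/-- Edges: the inclusion is the identity on underlying edges. [cite: MochizukiSemiAnbd2006, §1 p.12] -/
@[simp] theorem inclusion_edgeMap_coe (K K' : G.Subgraph) (hV : K.verts ⊆ K'.verts)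
    (hE : K.edges ⊆ K'.edges) (e : K.toSemiGraph.Edge) :
    ((inclusion K K' hV hE).edgeMap e).1 = e.1 := rfl

/-- Branches: the inclusion is the identity on underlying branches. [cite: MochizukiSemiAnbd2006, §1 p.12] -/
@[simp] theorem inclusion_branchMap_coe (K K' : G.Subgraph) (hV : K.verts ⊆ K'.verts)
    (hE : K.edges ⊆ K'.edges) (b : K.toSemiGraph.Branch) :
    ((inclusion K K' hV hE).branchMap b).1 = b.1 := rfl

/-- The inclusion commutes with the inclusions into `G`: `ι_{K̄} ∘ incl = ι_K`.
[cite: MochizukiSemiAnbd2006, §1 p.12] -/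
theorem inclusion_comp_ι (K K' : G.Subgraph) (hV : K.verts ⊆ K'.verts) (hE : K.edges ⊆ K'.edges) :
    inclusion K K' hV hE ≫ K'.ι = K.ι := rfl

end SemiGraph.Subgraph

/-! ### Semi-graphs of anabelioids: restricting objects of `B(𝒢|_{K̄})` further to `K` -/

namespace SemiGraphOfAnabelioids

variable (𝒢 : SemiGraphOfAnabelioids.{v₁, u₁, u}) (K' K : 𝒢.graph.Subgraph)
  (hV : K.verts ⊆ K'.verts) (hE : K.edges ⊆ K'.edges)

/-- **Nested restriction** `B(𝒢|_{K̄}) ⥤ B(𝒢|_K)` for `K ⊆ K̄`: restrict the data `(S_v, T_e, ψ_b)`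
of an object of `B(𝒢|_{K̄})` to the vertices, edges and branches of `K` (Def. 2.1 p. 24 applied to
the sub-semi-graph `K` of `K̄`; the constituents of `𝒢|_{K̄}` and `𝒢|_K` over `K` are the same
anabelioids `𝒢_v`, `𝒢_e`). [cite: MochizukiSemiAnbd2006, Def. 2.1 p.24] -/
noncomputable abbrev restrictFunctor₂ : (𝒢.restrict K').BObj ⥤ (𝒢.restrict K).BObj where
  obj A :=
    { S := fun v => A.S ⟨v.1, hV v.2⟩
      T := fun e => A.T ⟨e.1, hE e.2⟩
      ψ := fun b v h => A.ψ ((SemiGraph.Subgraph.inclusion K K' hV hE).branchMap b) ⟨v.1, hV v.2⟩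
        ((SemiGraph.Subgraph.inclusion K K' hV hE).abuts_branchMap b v h) }
  map f :=
    { fS := fun v => f.fS ⟨v.1, hV v.2⟩
      fT := fun e => f.fT ⟨e.1, hE e.2⟩
      comm := fun b v h =>
        f.comm ((SemiGraph.Subgraph.inclusion K K' hV hE).branchMap b) ⟨v.1, hV v.2⟩
          ((SemiGraph.Subgraph.inclusion K K' hV hE).abuts_branchMap b v h) }

/-- Vertex objects of the nested restriction. [cite: MochizukiSemiAnbd2006, Def. 2.1 p.24] -/
@[simp] theorem restrictFunctor₂_obj_S (A : (𝒢.restrict K').BObj) (v : K.toSemiGraph.Vertex) :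
    ((𝒢.restrictFunctor₂ K' K hV hE).obj A).S v = A.S ⟨v.1, hV v.2⟩ := rfl

/-- Edge objects of the nested restriction. [cite: MochizukiSemiAnbd2006, Def. 2.1 p.24] -/
@[simp] theorem restrictFunctor₂_obj_T (A : (𝒢.restrict K').BObj) (e : K.toSemiGraph.Edge) :
    ((𝒢.restrictFunctor₂ K' K hV hE).obj A).T e = A.T ⟨e.1, hE e.2⟩ := rfl

/-- **Restriction in stages:** `(−)|_{K̄} ⋙ restrictFunctor₂ = (−)|_K` (definitional).
[cite: MochizukiSemiAnbd2006, Def. 2.1 p.24] -/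
theorem restrictFunctor_comp_restrictFunctor₂ :
    𝒢.restrictFunctor K' ⋙ 𝒢.restrictFunctor₂ K' K hV hE = 𝒢.restrictFunctor K := rfl

/-- The nested restriction followed by restriction to a vertex `w ∈ K` is restriction to `w ∈ K̄`:
`restrictFunctor₂ ⋙ ρ^K_w = ρ^{K̄}_w` (definitional). [cite: MochizukiSemiAnbd2006, Def. 2.1 p.24] -/
theorem restrictFunctor₂_comp_ρ (w : K.toSemiGraph.Vertex) :
    𝒢.restrictFunctor₂ K' K hV hE ⋙ (𝒢.restrict K).ρ w = (𝒢.restrict K').ρ ⟨w.1, hV w.2⟩ := rfl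

/-- Hence the basepoints agree: `restrictFunctor₂ ⋙ (ρ^K_w ⋙ F) = ρ^{K̄}_w ⋙ F`, and
`π₁(restrictFunctor₂) : Π_K → Π_{K̄}` is the homomorphism induced by `K ⊆ K̄` for the basepoints
through `w`. [cite: MochizukiSemiAnbd2006, Def. 2.1 p.24] -/
theorem restrictFunctor₂_comp_ρ_comp (w : K.toSemiGraph.Vertex) (F : 𝒢.V w.1 ⥤ FintypeCat.{w}) :
    𝒢.restrictFunctor₂ K' K hV hE ⋙ ((𝒢.restrict K).ρ w ⋙ F) = (𝒢.restrict K').ρ ⟨w.1, hV w.2⟩ ⋙ F :=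
  rfl

/-- `Π_K → Π_𝒢` factors through `Π_K → Π_{K̄} → Π_𝒢`:
`π₁((−)|_K) = π₁((−)|_{K̄}) ∘ π₁(restrictFunctor₂)` for the basepoints through `w ∈ K`.
[cite: MochizukiSemiAnbd2006, Def. 2.1 p.24] -/
theorem piHToPi_eq_comp_restrictFunctor₂ (w : K.toSemiGraph.Vertex) (F : 𝒢.V w.1 ⥤ FintypeCat.{w}) :
    𝒢.piHToPi K w F =
      (𝒢.piHToPi K' ⟨w.1, hV w.2⟩ F).comp
        (pi1Map (𝒢.restrictFunctor₂ K' K hV hE) ((𝒢.restrict K).ρ w ⋙ F)) := rfl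

namespace Hom

variable {𝒢} {𝒢' : SemiGraphOfAnabelioids.{v₁, u₁, u}} (φ : Hom 𝒢' 𝒢) (H : 𝒢.graph.Subgraph)
  (K' K : 𝒢'.graph.Subgraph) (hVK : K.verts ⊆ K'.verts) (hEK : K.edges ⊆ K'.edges)
  (hV' : K'.verts ⊆ φ.base.vertexMap ⁻¹' H.verts) (hE' : K'.edges ⊆ φ.base.edgeMap ⁻¹' H.edges)
  (hV : K.verts ⊆ φ.base.vertexMap ⁻¹' H.verts) (hE : K.edges ⊆ φ.base.edgeMap ⁻¹' H.edges)

/-- **Pull-back along the restricted morphisms, in stages — on objects:**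
`((φ|_{K̄})^* A)|_K = (φ|_K)^* A` for `A ∈ B(𝒢|_ℍ)` (same vertex and edge objects, same gluing).
[cite: MochizukiSemiAnbd2006, Cor. 2.7(i) p.30] -/
theorem restrictFunctor₂_obj_restrict_pullbackFunctor_obj (A : (𝒢.restrict H).BObj) :
    (𝒢'.restrictFunctor₂ K' K hVK hEK).obj ((φ.restrict K' H hV' hE').pullbackFunctor.obj A) =
      (φ.restrict K H hV hE).pullbackFunctor.obj A := by
  change SemiGraphOfAnabelioids.BObj.mk _ _ _ = SemiGraphOfAnabelioids.BObj.mk _ _ _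
  congr 1

/-- **Pull-back along the restricted morphisms, in stages:** `(φ|_{K̄})^* ⋙ restrictFunctor₂ = (φ|_K)^*`
as functors `B(𝒢|_ℍ) ⥤ B(𝒢′|_K)`. [cite: MochizukiSemiAnbd2006, Cor. 2.7(i) p.30] -/
theorem restrict_pullbackFunctor_comp_restrictFunctor₂ :
    (φ.restrict K' H hV' hE').pullbackFunctor ⋙ 𝒢'.restrictFunctor₂ K' K hVK hEK =
      (φ.restrict K H hV hE).pullbackFunctor := by
  refine CategoryTheory.Functor.ext
    (fun A => φ.restrictFunctor₂_obj_restrict_pullbackFunctor_obj H K' K hVK hEK hV' hE' hV hE A)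
    (fun A B g => ?_)
  have key : ∀ {X Y X' Y' : (𝒢'.restrict K).BObj} (hX : X = X') (hY : Y = Y') (f : X ⟶ Y)
      (f' : X' ⟶ Y'), (∀ v, HEq (f.fS v) (f'.fS v)) → (∀ e, HEq (f.fT e) (f'.fT e)) →
      f = eqToHom hX ≫ f' ≫ eqToHom hY.symm := by
    intro X Y X' Y' hX hY f f' hS hT
    subst hX; subst hY
    simp only [eqToHom_refl, Category.comp_id, Category.id_comp]
    exact BObj.hom_ext _ _ (funext fun v => eq_of_heq (hS v)) (funext fun e => eq_of_heq (hT e))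
  exact key (φ.restrictFunctor₂_obj_restrict_pullbackFunctor_obj H K' K hVK hEK hV' hE' hV hE A)
    (φ.restrictFunctor₂_obj_restrict_pullbackFunctor_obj H K' K hVK hEK hV' hE' hV hE B) _ _
    (fun v => HEq.rfl) (fun e => HEq.rfl)

/-- The induced homomorphisms factor: `π₁((φ|_K)^*) = π₁((φ|_{K̄})^*)_{ρ^{K̄}_w ⋙ F′} ∘ π₁(restrictFunctor₂)`
for the basepoint through `w ∈ K`. [cite: MochizukiSemiAnbd2006, Cor. 2.7(i) p.30] -/
theorem pi1Map_restrict_pullbackFunctor_eq_comp (w : K.toSemiGraph.Vertex)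
    (F' : 𝒢'.V w.1 ⥤ FintypeCat.{w}) :
    pi1Map (φ.restrict K H hV hE).pullbackFunctor ((𝒢'.restrict K).ρ w ⋙ F') =
      (pi1Map (φ.restrict K' H hV' hE').pullbackFunctor ((𝒢'.restrict K').ρ ⟨w.1, hVK w.2⟩ ⋙ F')).comp
        (pi1Map (𝒢'.restrictFunctor₂ K' K hVK hEK) ((𝒢'.restrict K).ρ w ⋙ F')) :=
  -- `pi1Map (Q ⋙ P) F = (pi1Map Q (P ⋙ F)).comp (pi1Map P F)` holds by `rfl`
  eq_of_heq (congr_arg_heq (fun P => pi1Map P ((𝒢'.restrict K).ρ w ⋙ F'))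
    (φ.restrict_pullbackFunctor_comp_restrictFunctor₂ H K' K hVK hEK hV' hE' hV hE).symm)

/-- **`ι_{φ|_K} = ι_{φ|_{K̄}} ∘ π₁(restrictFunctor₂)`**: the homomorphism `Π_K → Π_ℍ` of the dictionary
(D3) (read through the constituent basepoints `F′` of `𝒢′_w`, `F` of `𝒢_{φ w}`, `e : φ_w^* ⋙ F′ ≅ F`)
factors through `Π_K → Π_{K̄}`. [cite: MochizukiSemiAnbd2006, Cor. 2.7(i) p.30] -/
theorem ι_restrict_eq_comp (w : K.toSemiGraph.Vertex) (F' : 𝒢'.V w.1 ⥤ FintypeCat.{w})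
    (F : 𝒢.V (φ.base.vertexMap w.1) ⥤ FintypeCat.{w}) (e : (φ.φV w.1).pullback ⋙ F' ≅ F) :
    (Aut.autMulEquivOfIso
          (Functor.isoWhiskerLeft ((𝒢.restrict H).ρ ⟨φ.base.vertexMap w.1, hV w.2⟩) e)).toMonoidHom.comp
        (pi1Map (φ.restrict K H hV hE).pullbackFunctor ((𝒢'.restrict K).ρ w ⋙ F')) =
      ((Aut.autMulEquivOfIso
            (Functor.isoWhiskerLeft ((𝒢.restrict H).ρ ⟨φ.base.vertexMap w.1, hV' (hVK w.2)⟩)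
              e)).toMonoidHom.comp
          (pi1Map (φ.restrict K' H hV' hE').pullbackFunctor
            ((𝒢'.restrict K').ρ ⟨w.1, hVK w.2⟩ ⋙ F'))).comp
        (pi1Map (𝒢'.restrictFunctor₂ K' K hVK hEK) ((𝒢'.restrict K).ρ w ⋙ F')) := by
  rw [MonoidHom.comp_assoc]
  exact congrArg _ (φ.pi1Map_restrict_pullbackFunctor_eq_comp H K' K hVK hEK hV' hE' hV hE w F')

/-- Hence `image(Π_K → Π_ℍ) = ι_{φ|_{K̄}}(image(Π_K → Π_{K̄}))`.
[cite: MochizukiSemiAnbd2006, Cor. 2.7(i) p.30] -/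
theorem range_ι_restrict_eq_map (w : K.toSemiGraph.Vertex) (F' : 𝒢'.V w.1 ⥤ FintypeCat.{w})
    (F : 𝒢.V (φ.base.vertexMap w.1) ⥤ FintypeCat.{w}) (e : (φ.φV w.1).pullback ⋙ F' ≅ F) :
    ((Aut.autMulEquivOfIso
          (Functor.isoWhiskerLeft ((𝒢.restrict H).ρ ⟨φ.base.vertexMap w.1, hV w.2⟩) e)).toMonoidHom.comp
        (pi1Map (φ.restrict K H hV hE).pullbackFunctor ((𝒢'.restrict K).ρ w ⋙ F'))).range =
      (pi1Map (𝒢'.restrictFunctor₂ K' K hVK hEK) ((𝒢'.restrict K).ρ w ⋙ F')).range.map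
        ((Aut.autMulEquivOfIso
            (Functor.isoWhiskerLeft ((𝒢.restrict H).ρ ⟨φ.base.vertexMap w.1, hV' (hVK w.2)⟩)
              e)).toMonoidHom.comp
          (pi1Map (φ.restrict K' H hV' hE').pullbackFunctor
            ((𝒢'.restrict K').ρ ⟨w.1, hVK w.2⟩ ⋙ F'))) :=
  (congrArg MonoidHom.range (φ.ι_restrict_eq_comp H K' K hVK hEK hV' hE' hV hE w F' F e)).trans
    (MonoidHom.range_comp _ _)

/-- **(COMP) reduced to a surjectivity:** if `Π_K → Π_{K̄}` (for the basepoints through `w ∈ K`) is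
onto — as it is when `K` is a union of connected components of `K̄` — then
`image(Π_K → Π_ℍ) = image(Π_{K̄} → Π_ℍ)`. [cite: MochizukiSemiAnbd2006, Cor. 2.7(i) p.30] -/
theorem range_ι_restrict_eq_of_surjective (w : K.toSemiGraph.Vertex)
    (F' : 𝒢'.V w.1 ⥤ FintypeCat.{w}) (F : 𝒢.V (φ.base.vertexMap w.1) ⥤ FintypeCat.{w})
    (e : (φ.φV w.1).pullback ⋙ F' ≅ F)
    (hs : Function.Surjective
      (pi1Map (𝒢'.restrictFunctor₂ K' K hVK hEK) ((𝒢'.restrict K).ρ w ⋙ F'))) :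
    ((Aut.autMulEquivOfIso
          (Functor.isoWhiskerLeft ((𝒢.restrict H).ρ ⟨φ.base.vertexMap w.1, hV w.2⟩) e)).toMonoidHom.comp
        (pi1Map (φ.restrict K H hV hE).pullbackFunctor ((𝒢'.restrict K).ρ w ⋙ F'))).range =
      ((Aut.autMulEquivOfIso
            (Functor.isoWhiskerLeft ((𝒢.restrict H).ρ ⟨φ.base.vertexMap w.1, hV' (hVK w.2)⟩)
              e)).toMonoidHom.comp
          (pi1Map (φ.restrict K' H hV' hE').pullbackFunctor
            ((𝒢'.restrict K').ρ ⟨w.1, hVK w.2⟩ ⋙ F'))).range :=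
  (φ.range_ι_restrict_eq_map H K' K hVK hEK hV' hE' hV hE w F' F e).trans
    (((congrArg (Subgroup.map _) (MonoidHom.range_eq_top_of_surjective _ hs)).trans
      (MonoidHom.range_eq_map _).symm))

end Hom

end SemiGraphOfAnabelioids

end Literature.AnabelianGeometry.SemiGraphs
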